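import Summits.QuantumFields.BalabanUV.Beta.GAN24.DirichletRingDecay

/-!
# `BalabanUV.Beta.GAN24.DirichletRingWeighted` — binder row G-an2-4 / (CONV-C), road P2 PART IV, leaf L9 of the ring lemma (model
# coordinates): THE INVERSE-DISTANCE-WEIGHTED ENERGY AROUND A RE-ENTRANT VERTEX IS BOUNDED AT THE CRITICAL SCALE
# (unit b2b-balaban-gan24-p2, gen 25, v1)

HONEST FRAMING (cell contract, verbatim): «discharging `BetaPertH` makes Bałaban's UV stability UNCONDITIONAL — a real constructive-QFT
result; it is NOT the continuum limit and NOT the Clay problem.»  Leaf L9 of memo `HOME/b2b-balaban-gan24-p2/gen24/W-FULL-WEIGHTED.md` §3 in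
MODEL COORDINATES, lattice units (objects of `DirichletRingEnergies`; hypotheses of `DirichletRingDecay.ring_energy_decay`): the bonds
around a re-entrant vertex are partitioned into the rings' tangential bonds `Tan_k` and outward bonds `Rad_k` (`k ≥ 1`), all at lattice
distance `≥ k − ½` from the vertex, and `Tan_k + Rad_k = Ẽ_k − Ẽ_{k−1}` (`DirichletRingEnergies.Et_succ_sub`).  Binder (B) of memo §2 near the
vertex is therefore the ABEL SUM `Σ_{k=1}^{n} (Ẽ_k − Ẽ_{k−1})/k`:
 * §1 `abel_inv` — `Σ_{k=1}^{n} (e_k − e_{k−1})/k = e_n/n − e_0 + Σ_{k=1}^{n−1} e_k·(1/k − 1/(k+1))` (summation by parts);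
 * §2 `decay_weight_le` — `((k+3)/(n+3))^γ·(1/k − 1/(k+1)) ≤ 16·k^{γ−2}/(n+3)^γ` for `1 ≤ k`, `0 ≤ γ ≤ 2`;
 * §3 **`weighted_ring_energy_le`** — under the hypotheses of the ring lemma (`U = 0` on the quadrant, `ΔU = G` on `Q_n ∖ quadrant`,
   `0 < ε`, `γ := (π/3)(1−ε/2) > 1`) and `1 ≤ n`:
   `Σ_{k=1}^{n} (Tan_k + Rad_k)/k ≤ (Ẽ_n + (16/(γ−1))·(Ẽ_n + (π/(2ε))·SG_n·(n+3)²/(2−γ)))/n`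
   (`DirichletRingDecay.ring_energy_decay` for every `k < n` + `DirichletRingGronwall.sum_rpow_sub_one_le` with `s = γ − 1`).
In block units (`r ≍ k/n`) the left side times `n` is the inverse-weighted energy `Σ r⁻¹|δu|²` near the vertex and the right side times `n`
is `≍ Ẽ_n + n²·SG_n` = the critical size (total energy + `n²·‖ΔU‖²`), uniformly in `n` — the d = 2 content of binder (B); the transfer to
the torus Dirichlet problem and the sum over vertices is leaf L14 (NOT here).

ABSOLUTE RULE (cell, verbatim): «No internally-minted statement may enter as a cited fact. Every hypothesis is either kernel-proved in
this package or a verbatim quotation of a PUBLISHED theorem with page reference. The manuscript(s) under audit are NOT citable for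
their own disputed steps — they are the thing under adjudication; programme-internal (2001/route/tribunal) claims are never citable.»
[folklore] finite sums + elementary real analysis; nothing printed is a hypothesis.  NOT CLAIMED: (B)/(A) on the torus (L14/L12), NE2, (CONV-C),
`BetaPertH`, continuum, Clay.  «not in print; our proof attempt».  HONEST DEPENDENCY: continuum YM on T⁴ ⇐ BetaPertH ∧ nine spine estimates
(0/9 proved); BetaPertH ⇐ (D1) ∧ (D4) ∧ CAP+tail; G-an2-4 gates asym, D1 and NE2/3/4.
-/

noncomputable section

open scoped BigOperators
open Finset

namespace Summit.QuantumFields.BalabanUV.Beta.GAN24.DirichletRingWeighted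

open DirichletRingEnergies (Tan Rad Et sqSum lap Tan_nonneg Rad_nonneg Et_nonneg Et_zero Et_succ_sub sqSum_nonneg)
open DirichletRingGronwall (sum_rpow_sub_one_le)
open DirichletRingDecay (ring_energy_decay)

variable (U : ℤ → ℤ → ℂ)

/-! ## §1 Abel summation with the weights `1/k` -/

/-- **summation by parts**: for `n ≥ 1`, `Σ_{k=1}^{n} (e_k − e_{k−1})/k = e_n/n − e_0 + Σ_{k=1}^{n−1} e_k·(1/k − 1/(k+1))`. [folklore] -/
theorem abel_inv (e : ℕ → ℝ) {n : ℕ} (hn : 1 ≤ n) :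
    ∑ k ∈ Icc 1 n, (e k - e (k - 1)) / k = e n / n - e 0 + ∑ k ∈ Ico 1 n, e k * (1 / k - 1 / ((k : ℝ) + 1)) := by
  induction n, hn using Nat.le_induction with
  | base => simp
  | succ n hn ih =>
      rw [sum_Icc_succ_top (by omega), ih, sum_Ico_succ_top hn, Nat.add_sub_cancel]
      have hn0 : (n : ℝ) ≠ 0 := by exact_mod_cast (by omega : n ≠ 0)
      have hn1 : (n : ℝ) + 1 ≠ 0 := by positivity
      push_cast
      field_simp
      ring

/-! ## §2 The weight of one ring under the decay -/

/-- `((k+3)/(n+3))^γ·(1/k − 1/(k+1)) ≤ 16·k^{γ−2}/(n+3)^γ` for `1 ≤ k` and `0 ≤ γ ≤ 2`. [folklore] -/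
theorem decay_weight_le {γ : ℝ} (hγ0 : 0 ≤ γ) (hγ2 : γ ≤ 2) {k : ℕ} (hk : 1 ≤ k) (n : ℕ) :
    (((k : ℝ) + 3) / ((n : ℝ) + 3)) ^ γ * (1 / (k : ℝ) - 1 / ((k : ℝ) + 1))
      ≤ 16 * (k : ℝ) ^ (γ - 2) / ((n : ℝ) + 3) ^ γ := by
  have hkR : (1 : ℝ) ≤ k := by exact_mod_cast hk
  have hk0 : (0 : ℝ) < k := by linarith
  have hn3 : (0 : ℝ) < (n : ℝ) + 3 := by positivity
  -- the weight `1/k − 1/(k+1) = 1/(k(k+1)) ≤ 1/k²`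
  have hw0 : 0 ≤ 1 / (k : ℝ) - 1 / ((k : ℝ) + 1) := by
    rw [div_sub_div _ _ hk0.ne' (by positivity), le_div_iff₀ (by positivity)]; linarith
  have hw : 1 / (k : ℝ) - 1 / ((k : ℝ) + 1) ≤ 1 / (k : ℝ) ^ 2 := by
    rw [div_sub_div _ _ hk0.ne' (by positivity), div_le_div_iff₀ (by positivity) (by positivity)]; nlinarith
  -- the power `(k+3)^γ ≤ (4k)^γ = 4^γ k^γ ≤ 16 k^γ`
  have hp : ((k : ℝ) + 3) ^ γ ≤ 16 * (k : ℝ) ^ γ := by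
    calc ((k : ℝ) + 3) ^ γ ≤ (4 * (k : ℝ)) ^ γ := Real.rpow_le_rpow (by positivity) (by linarith) hγ0
      _ = (4 : ℝ) ^ γ * (k : ℝ) ^ γ := Real.mul_rpow (by norm_num) hk0.le
      _ ≤ (4 : ℝ) ^ (2 : ℝ) * (k : ℝ) ^ γ :=
          mul_le_mul_of_nonneg_right (Real.rpow_le_rpow_of_exponent_le (by norm_num) hγ2) (Real.rpow_nonneg hk0.le γ)
      _ = 16 * (k : ℝ) ^ γ := by rw [Real.rpow_two]; norm_num
  have hsub : (k : ℝ) ^ (γ - 2) = (k : ℝ) ^ γ / (k : ℝ) ^ 2 := by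
    rw [Real.rpow_sub hk0, Real.rpow_two]
  rw [Real.div_rpow (by positivity) hn3.le, hsub]
  have hkγ : 0 ≤ (k : ℝ) ^ γ := Real.rpow_nonneg hk0.le γ
  have hnγ : 0 < ((n : ℝ) + 3) ^ γ := Real.rpow_pos_of_pos hn3 γ
  calc ((k : ℝ) + 3) ^ γ / ((n : ℝ) + 3) ^ γ * (1 / (k : ℝ) - 1 / ((k : ℝ) + 1))
      ≤ (16 * (k : ℝ) ^ γ) / ((n : ℝ) + 3) ^ γ * (1 / (k : ℝ) ^ 2) :=
        mul_le_mul (div_le_div_of_nonneg_right hp hnγ.le) hw hw0 (by positivity)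
    _ = 16 * ((k : ℝ) ^ γ / (k : ℝ) ^ 2) / ((n : ℝ) + 3) ^ γ := by
        field_simp

/-! ## §3 The weighted ring energy -/

/-- **THE INVERSE-WEIGHTED ENERGY AROUND A RE-ENTRANT VERTEX (leaf L9, model coordinates)**: under the hypotheses of
`DirichletRingDecay.ring_energy_decay` and `1 ≤ n`,
`Σ_{k=1}^{n} (Tan_k + Rad_k)/k ≤ (Ẽ_n + (16/(γ−1))·(Ẽ_n + (π/(2ε))·SG_n·(n+3)²/(2−γ)))/n`, `γ = (π/3)(1−ε/2)`. [folklore] -/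
theorem weighted_ring_energy_le {n : ℕ} (hn : 1 ≤ n) (G : ℤ → ℤ → ℂ)
    (hU : ∀ s t : ℤ, 0 ≤ s → 0 ≤ t → U s t = 0)
    (hEq : ∀ i j : ℤ, -(n : ℤ) ≤ i → i < n → -(n : ℤ) ≤ j → j < n → ¬(0 ≤ i ∧ 0 ≤ j) → lap U i j = G i j)
    {ε : ℝ} (hε : 0 < ε) (hγ : 1 < Real.pi / 3 * (1 - ε / 2)) :
    ∑ k ∈ Icc 1 n, (Tan U k + Rad U k) / k
      ≤ (Et U n + 16 / (Real.pi / 3 * (1 - ε / 2) - 1)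
          * (Et U n + (Real.pi / (2 * ε) * sqSum (fun i j => ‖G i j‖ ^ 2) n) * ((n : ℝ) + 3) ^ 2
              / (2 - Real.pi / 3 * (1 - ε / 2)))) / n := by
  set γ : ℝ := Real.pi / 3 * (1 - ε / 2) with hγdef
  set SG : ℝ := sqSum (fun i j => ‖G i j‖ ^ 2) n with hSG
  set M : ℝ := Et U n + (Real.pi / (2 * ε) * SG) * ((n : ℝ) + 3) ^ 2 / (2 - γ) with hM
  have hπ3 := Real.pi_gt_three
  have hπ4 := Real.pi_lt_four
  have hε2 : ε < 2 := by
    by_contra h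
    have : Real.pi / 3 * (1 - ε / 2) ≤ 0 := mul_nonpos_of_nonneg_of_nonpos (by positivity) (by linarith)
    linarith
  have hγ2 : γ < 2 := by
    have : Real.pi / 3 * (1 - ε / 2) < Real.pi / 3 * 1 := mul_lt_mul_of_pos_left (by linarith) (by positivity)
    rw [hγdef]; linarith
  have hγ1 : 0 < γ - 1 := by rw [hγdef]; linarith
  have hnR : (1 : ℝ) ≤ n := by exact_mod_cast hn
  have hn0 : (0 : ℝ) < n := by linarith
  have hSG0 : 0 ≤ SG := sqSum_nonneg _ (fun _ _ => sq_nonneg _) _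
  have hM0 : 0 ≤ M := by
    have := Et_nonneg U n
    have h2 : 0 < 2 - γ := by linarith
    positivity
  -- the increments are the ring energies
  have hinc : ∀ k ∈ Icc 1 n, (Tan U k + Rad U k) / k = (Et U k - Et U (k - 1)) / k := by
    intro k hk
    obtain ⟨hk1, -⟩ := mem_Icc.mp hk
    obtain ⟨j, rfl⟩ : ∃ j, k = j + 1 := ⟨k - 1, by omega⟩
    rw [Nat.add_sub_cancel, Et_succ_sub]
  rw [sum_congr rfl hinc, abel_inv (fun k => Et U k) hn, Et_zero, sub_zero]
  -- each term of the Abel sum under the decay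
  have hterm : ∀ k ∈ Ico 1 n, Et U k * (1 / (k : ℝ) - 1 / ((k : ℝ) + 1)) ≤ M * (16 * (k : ℝ) ^ (γ - 2) / ((n : ℝ) + 3) ^ γ) := by
    intro k hk
    obtain ⟨hk1, hkn⟩ := mem_Ico.mp hk
    have hdec := ring_energy_decay U G hU hEq hε hγ hkn.le le_rfl
    have hk0 : (0 : ℝ) < k := by exact_mod_cast hk1
    have hw0 : 0 ≤ 1 / (k : ℝ) - 1 / ((k : ℝ) + 1) := by
      rw [div_sub_div _ _ hk0.ne' (by positivity), le_div_iff₀ (by positivity)]; linarith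
    have hρ0 : 0 ≤ (((k : ℝ) + 3) / ((n : ℝ) + 3)) ^ γ := Real.rpow_nonneg (by positivity) γ
    calc Et U k * (1 / (k : ℝ) - 1 / ((k : ℝ) + 1))
        ≤ ((((k : ℝ) + 3) / ((n : ℝ) + 3)) ^ γ * M) * (1 / (k : ℝ) - 1 / ((k : ℝ) + 1)) :=
          mul_le_mul_of_nonneg_right hdec hw0
      _ = M * ((((k : ℝ) + 3) / ((n : ℝ) + 3)) ^ γ * (1 / (k : ℝ) - 1 / ((k : ℝ) + 1))) := by ring
      _ ≤ M * (16 * (k : ℝ) ^ (γ - 2) / ((n : ℝ) + 3) ^ γ) :=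
          mul_le_mul_of_nonneg_left (decay_weight_le (by linarith) hγ2.le hk1 n) hM0
  -- the power sum `Σ_{k<n} k^{γ−2} ≤ n^{γ−1}/(γ−1)`
  have hpow : ∑ k ∈ Ico 1 n, (k : ℝ) ^ (γ - 2) ≤ (n : ℝ) ^ (γ - 1) / (γ - 1) := by
    have h1 : ∑ k ∈ Ico 1 n, (k : ℝ) ^ (γ - 2) ≤ ∑ k ∈ Icc 1 n, (k : ℝ) ^ ((γ - 1) - 1) := by
      rw [show γ - 2 = (γ - 1) - 1 by ring]
      exact sum_le_sum_of_subset_of_nonneg (fun k hk => by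
        have := mem_Ico.mp hk; exact mem_Icc.mpr ⟨this.1, this.2.le⟩) fun k _ _ => Real.rpow_nonneg (Nat.cast_nonneg k) _
    exact h1.trans (sum_rpow_sub_one_le hγ1 (by linarith) n)
  -- `n^{γ−1}/(n+3)^γ ≤ 1/n`
  have hn3 : (0 : ℝ) < (n : ℝ) + 3 := by positivity
  have hnγ : 0 < ((n : ℝ) + 3) ^ γ := Real.rpow_pos_of_pos hn3 γ
  have hratio : (n : ℝ) ^ (γ - 1) / ((n : ℝ) + 3) ^ γ ≤ 1 / n := by
    rw [div_le_div_iff₀ hnγ hn0, one_mul, Real.rpow_sub_one hn0.ne', div_mul_cancel₀ _ hn0.ne']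
    exact Real.rpow_le_rpow hn0.le (by linarith) (by linarith)
  -- assemble
  have hsum : ∑ k ∈ Ico 1 n, Et U k * (1 / (k : ℝ) - 1 / ((k : ℝ) + 1)) ≤ 16 * M / (γ - 1) / n := by
    calc ∑ k ∈ Ico 1 n, Et U k * (1 / (k : ℝ) - 1 / ((k : ℝ) + 1))
        ≤ ∑ k ∈ Ico 1 n, M * (16 * (k : ℝ) ^ (γ - 2) / ((n : ℝ) + 3) ^ γ) := sum_le_sum hterm
      _ = 16 * M / ((n : ℝ) + 3) ^ γ * ∑ k ∈ Ico 1 n, (k : ℝ) ^ (γ - 2) := by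
          rw [mul_sum]; refine sum_congr rfl fun k _ => ?_; field_simp
      _ ≤ 16 * M / ((n : ℝ) + 3) ^ γ * ((n : ℝ) ^ (γ - 1) / (γ - 1)) :=
          mul_le_mul_of_nonneg_left hpow (by positivity)
      _ = 16 * M / (γ - 1) * ((n : ℝ) ^ (γ - 1) / ((n : ℝ) + 3) ^ γ) := by
          field_simp
      _ ≤ 16 * M / (γ - 1) * (1 / n) := mul_le_mul_of_nonneg_left hratio (by positivity)
      _ = 16 * M / (γ - 1) / n := by field_simp
  have hfinal : Et U n / n + ∑ k ∈ Ico 1 n, Et U k * (1 / (k : ℝ) - 1 / ((k : ℝ) + 1))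
      ≤ (Et U n + 16 / (γ - 1) * M) / n := by
    rw [add_div]
    have e : 16 / (γ - 1) * M / n = 16 * M / (γ - 1) / n := by ring
    rw [e]
    linarith [hsum]
  simpa only [hM, hγdef, hSG] using hfinal

end Summit.QuantumFields.BalabanUV.Beta.GAN24.DirichletRingWeighted

end
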